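import Summits.KontsevichZagierPeriods.Zeta5Search.Barrier.ConeGammaCritCubic
import Summits.KontsevichZagierPeriods.Zeta5Search.Barrier.ConeGammaCritRootTracking

/-!
# ζ(5) search — BARRIER: the concrete inputs of the perturbation argument (smoothness, side condition, value map)

HONEST FRAMING (cell `pub-zeta5`): systematic search; no irrationality claim unless kernel-certified. MODEL objects
under Brown–Zudilin's (28)+(30) accounting ([BZ22] = arXiv:2210.03391; (28) observed, not proved); statements about
BZ's §5 critical system (`ConeGammaRates.IsCritical/critVals`) in the symmetric coordinates of `ConeGammaCritCubic`;
nothing here is a statement about the size of any critical value, the cone's supremum (C2 = `BarrierC2`, OPEN),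
S-E (CONJECTURED) or `ζ(5)`. No number or sentence of record moves. Records in print UNMOVED. Prover P2 g23
(self-selected Lean-only item «BZ's cubic (20) in the kernel», file 4: the concrete facts fed into the abstract
`ConeGammaCritBranches.exists_three_branches` by `ConeGammaRegularOpen`).

With `P = (Y−s₁)(Y−s₂)(Y−s₇)`, `Q = (Y+s₆)(s₁+s₂+s₇−Y)(s₀−Y) − P`, the cubic `C` of `ConeGammaCritCubic`, the point
`(x, y) = (s₆ − Y + (s₆−s₀)P/Q, Y + s₆)` over a root `Y`, the SIDE CONDITION `Q·Π(twelve arguments)` and the VALUE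
`log|λ|(x, y)` — all written out (no definitions are introduced; the expressions are long but explicit):
* `forall_critFactors_aOfS_iff` — the twelve non-vanishing conditions as explicit conjuncts;
* `contDiff_critCubic`, `continuous_critCubic` — the cubic is `C¹` in `(s, Y)` and continuous in `Y` (`fun_prop`);
* `critSide_ne_zero_iff`, `continuousAt_critSide` — the side condition: meaning and continuity where non-zero;
* `contDiffAt_critValue` — the value map is `C¹` in `(s, Y)` at an admissible root of an open-box parameter
  (`growthLogR_aOfS` + `fun_prop`: logarithms of non-vanishing arguments);
* `critValue_mem_critVals` — bridge: an admissible root gives a critical value (`isCritical_aOfS_of_root`);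
* `exists_openBox_ball` — the open box is open (a sup-ball around an open-box parameter stays inside);
* **`exists_roots_of_regular`** — at a Regular open-box parameter the cubic is `a·(Y−Y₁)(Y−Y₂)(Y−Y₃)`, `a ≠ 0`,
  with three pairwise distinct admissible roots whose values are sorted `v(Y₁) < v(Y₂) < v(Y₃)`.
-/

noncomputable section

open Set Metric
open scoped Topology

namespace Summit.KontsevichZagierPeriods.Zeta5Search.Barrier.ConeGamma

/-! ### The twelve factors as explicit conjuncts -/

/-- The twelve non-vanishing conditions of `IsCritical (aOfS s)` as explicit conjuncts. -/
theorem forall_critFactors_aOfS_iff (s : Fin 8 → ℝ) (x y : ℝ) :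
    (∀ k, critFactors (pR (aOfS s)) (qR (aOfS s)) x y k ≠ 0) ↔
      (x - (s 4 + s 6) ≠ 0 ∧ x - (s 3 + s 6) ≠ 0 ∧ x - (s 5 + s 6) ≠ 0 ∧ x + y - (s 0 + s 6) ≠ 0 ∧
        s 0 + s 6 - x ≠ 0 ∧ s 3 + s 4 + s 5 + s 6 - x ≠ 0 ∧ x + y - 2 * s 6 ≠ 0 ∧ y - (s 6 + s 7) ≠ 0 ∧
        y - (s 2 + s 6) ≠ 0 ∧ y - (s 1 + s 6) ≠ 0 ∧ s 1 + s 2 + s 6 + s 7 - y ≠ 0 ∧ s 0 + s 6 - y ≠ 0) := by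
  rw [critFactors_aOfS]
  constructor
  · intro h
    exact ⟨by simpa using h 0, by simpa using h 1, by simpa using h 2, by simpa using h 3, by simpa using h 4,
      by simpa using h 5, by simpa using h 6, by simpa using h 7, by simpa using h 8, by simpa using h 9,
      by simpa using h 10, by simpa using h 11⟩
  · rintro ⟨h0, h1, h2, h3, h4, h5, h6, h7, h8, h9, h10, h11⟩ k
    fin_cases k
    · simpa using h0
    · simpa using h1
    · simpa using h2
    · simpa using h3
    · simpa using h4
    · simpa using h5
    · simpa using h6
    · simpa using h7
    · simpa using h8
    · simpa using h9
    · simpa using h10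
    · simpa using h11

/-! ### The concrete inputs: smoothness, side condition, value map, bridge, open box -/

/-- The cubic is a polynomial in `(s, Y)`, hence `C¹`. -/
theorem contDiff_critCubic : ContDiff ℝ 1 (fun p : (Fin 8 → ℝ) × ℝ =>
    (-((p.2 + p.1 3) * (p.2 + p.1 4) * (p.2 + p.1 6) * (p.2 + p.1 5)) * (p.1 1 + p.1 2 + p.1 7 -
    p.2) ^ 2 * (p.1 0 - p.2) + (2 * p.2 ^ 3 - 2 * (p.1 0 - (p.1 3 + p.1 4 + p.1 6 + p.1 5)) *
    p.2 ^ 2 - (p.1 0 * (p.1 3 + p.1 4 + p.1 6 + p.1 5) - (p.1 3 * p.1 4 + p.1 3 * p.1 6 + p.1 3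
    * p.1 5 + p.1 4 * p.1 6 + p.1 4 * p.1 5 + p.1 6 * p.1 5)) * p.2 - (p.1 0 * (p.1 3 * p.1 4 +
    p.1 3 * p.1 6 + p.1 3 * p.1 5 + p.1 4 * p.1 6 + p.1 4 * p.1 5 + p.1 6 * p.1 5) - (p.1 3 *
    p.1 4 * p.1 6 + p.1 3 * p.1 4 * p.1 5 + p.1 3 * p.1 6 * p.1 5 + p.1 4 * p.1 6 * p.1 5))) *
    (p.1 1 + p.1 2 + p.1 7 - p.2) * ((p.2 - p.1 1) * (p.2 - p.1 2) * (p.2 - p.1 7)) + (p.2 - p.1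
    0 + (p.1 3 + p.1 4 + p.1 6 + p.1 5)) * ((p.2 - p.1 1) * (p.2 - p.1 2) * (p.2 - p.1 7)) ^ 2)) := by
  fun_prop

/-- The cubic is continuous in `Y`. -/
theorem continuous_critCubic (s : Fin 8 → ℝ) : Continuous (fun Y : ℝ =>
    (-((Y + s 3) * (Y + s 4) * (Y + s 6) * (Y + s 5)) * (s 1 + s 2 + s 7 - Y) ^ 2 * (s 0 - Y) + (2 *
    Y ^ 3 - 2 * (s 0 - (s 3 + s 4 + s 6 + s 5)) * Y ^ 2 - (s 0 * (s 3 + s 4 + s 6 + s 5) - (s 3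
    * s 4 + s 3 * s 6 + s 3 * s 5 + s 4 * s 6 + s 4 * s 5 + s 6 * s 5)) * Y - (s 0 * (s 3 * s 4
    + s 3 * s 6 + s 3 * s 5 + s 4 * s 6 + s 4 * s 5 + s 6 * s 5) - (s 3 * s 4 * s 6 + s 3 * s 4
    * s 5 + s 3 * s 6 * s 5 + s 4 * s 6 * s 5))) * (s 1 + s 2 + s 7 - Y) * ((Y - s 1) * (Y - s
    2) * (Y - s 7)) + (Y - s 0 + (s 3 + s 4 + s 6 + s 5)) * ((Y - s 1) * (Y - s 2) * (Y - s 7))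
    ^ 2)) := by
  fun_prop

/-- **The side condition** — the product of `Q(Y)` and the twelve arguments of the growth functional at the point
`(s₆ − Y + (s₆−s₀)P/Q, Y + s₆)` — is non-zero iff `Q(Y) ≠ 0` and the twelve arguments are non-zero. -/
theorem critSide_ne_zero_iff (s : Fin 8 → ℝ) (Y : ℝ) :
    ((Y + s 6) * ((s 1 + s 2 + s 7 - Y) * (s 0 - Y)) - (Y - s 1) * (Y - s 2) * (Y - s 7)) * ((s 6 -
      Y + (s 6 - s 0) * ((Y - s 1) * (Y - s 2) * (Y - s 7)) / ((Y + s 6) * ((s 1 + s 2 + s 7 -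
      Y) * (s 0 - Y)) - (Y - s 1) * (Y - s 2) * (Y - s 7))) - (s 4 + s 6)) * ((s 6 - Y + (s 6 -
      s 0) * ((Y - s 1) * (Y - s 2) * (Y - s 7)) / ((Y + s 6) * ((s 1 + s 2 + s 7 - Y) * (s 0 -
      Y)) - (Y - s 1) * (Y - s 2) * (Y - s 7))) - (s 3 + s 6)) * ((s 6 - Y + (s 6 - s 0) * ((Y -
      s 1) * (Y - s 2) * (Y - s 7)) / ((Y + s 6) * ((s 1 + s 2 + s 7 - Y) * (s 0 - Y)) - (Y - s
      1) * (Y - s 2) * (Y - s 7))) - (s 5 + s 6)) * ((s 6 - Y + (s 6 - s 0) * ((Y - s 1) * (Y -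
      s 2) * (Y - s 7)) / ((Y + s 6) * ((s 1 + s 2 + s 7 - Y) * (s 0 - Y)) - (Y - s 1) * (Y - s
      2) * (Y - s 7))) + (Y + s 6) - (s 0 + s 6)) * (s 0 + s 6 - (s 6 - Y + (s 6 - s 0) * ((Y -
      s 1) * (Y - s 2) * (Y - s 7)) / ((Y + s 6) * ((s 1 + s 2 + s 7 - Y) * (s 0 - Y)) - (Y - s
      1) * (Y - s 2) * (Y - s 7)))) * (s 3 + s 4 + s 5 + s 6 - (s 6 - Y + (s 6 - s 0) * ((Y - s
      1) * (Y - s 2) * (Y - s 7)) / ((Y + s 6) * ((s 1 + s 2 + s 7 - Y) * (s 0 - Y)) - (Y - s 1)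
      * (Y - s 2) * (Y - s 7)))) * ((s 6 - Y + (s 6 - s 0) * ((Y - s 1) * (Y - s 2) * (Y - s 7))
      / ((Y + s 6) * ((s 1 + s 2 + s 7 - Y) * (s 0 - Y)) - (Y - s 1) * (Y - s 2) * (Y - s 7))) +
      (Y + s 6) - 2 * s 6) * ((Y + s 6) - (s 6 + s 7)) * ((Y + s 6) - (s 2 + s 6)) * ((Y + s 6)
      - (s 1 + s 6)) * (s 1 + s 2 + s 6 + s 7 - (Y + s 6)) * (s 0 + s 6 - (Y + s 6)) ≠ 0 ↔
      ((Y + s 6) * ((s 1 + s 2 + s 7 - Y) * (s 0 - Y)) - (Y - s 1) * (Y - s 2) * (Y - s 7)) ≠ 0 ∧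
      ∀ k, critFactors (pR (aOfS s)) (qR (aOfS s))
        (s 6 - Y + (s 6 - s 0) * ((Y - s 1) * (Y - s 2) * (Y - s 7)) / ((Y + s 6) * ((s 1 + s 2 + s 7 -
        Y) * (s 0 - Y)) - (Y - s 1) * (Y - s 2) * (Y - s 7))) (Y + s 6) k ≠ 0 := by
  rw [forall_critFactors_aOfS_iff]
  simp only [mul_ne_zero_iff, and_assoc]

/-- The side condition is continuous in `(s, Y)` wherever it is non-zero (only `Q ≠ 0` is used). -/
theorem continuousAt_critSide {s : Fin 8 → ℝ} {Y : ℝ}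
    (hside : ((Y + s 6) * ((s 1 + s 2 + s 7 - Y) * (s 0 - Y)) - (Y - s 1) * (Y - s 2) * (Y - s 7)) * ((s 6 -
      Y + (s 6 - s 0) * ((Y - s 1) * (Y - s 2) * (Y - s 7)) / ((Y + s 6) * ((s 1 + s 2 + s 7 -
      Y) * (s 0 - Y)) - (Y - s 1) * (Y - s 2) * (Y - s 7))) - (s 4 + s 6)) * ((s 6 - Y + (s 6 -
      s 0) * ((Y - s 1) * (Y - s 2) * (Y - s 7)) / ((Y + s 6) * ((s 1 + s 2 + s 7 - Y) * (s 0 -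
      Y)) - (Y - s 1) * (Y - s 2) * (Y - s 7))) - (s 3 + s 6)) * ((s 6 - Y + (s 6 - s 0) * ((Y -
      s 1) * (Y - s 2) * (Y - s 7)) / ((Y + s 6) * ((s 1 + s 2 + s 7 - Y) * (s 0 - Y)) - (Y - s
      1) * (Y - s 2) * (Y - s 7))) - (s 5 + s 6)) * ((s 6 - Y + (s 6 - s 0) * ((Y - s 1) * (Y -
      s 2) * (Y - s 7)) / ((Y + s 6) * ((s 1 + s 2 + s 7 - Y) * (s 0 - Y)) - (Y - s 1) * (Y - s
      2) * (Y - s 7))) + (Y + s 6) - (s 0 + s 6)) * (s 0 + s 6 - (s 6 - Y + (s 6 - s 0) * ((Y -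
      s 1) * (Y - s 2) * (Y - s 7)) / ((Y + s 6) * ((s 1 + s 2 + s 7 - Y) * (s 0 - Y)) - (Y - s
      1) * (Y - s 2) * (Y - s 7)))) * (s 3 + s 4 + s 5 + s 6 - (s 6 - Y + (s 6 - s 0) * ((Y - s
      1) * (Y - s 2) * (Y - s 7)) / ((Y + s 6) * ((s 1 + s 2 + s 7 - Y) * (s 0 - Y)) - (Y - s 1)
      * (Y - s 2) * (Y - s 7)))) * ((s 6 - Y + (s 6 - s 0) * ((Y - s 1) * (Y - s 2) * (Y - s 7))
      / ((Y + s 6) * ((s 1 + s 2 + s 7 - Y) * (s 0 - Y)) - (Y - s 1) * (Y - s 2) * (Y - s 7))) +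
      (Y + s 6) - 2 * s 6) * ((Y + s 6) - (s 6 + s 7)) * ((Y + s 6) - (s 2 + s 6)) * ((Y + s 6)
      - (s 1 + s 6)) * (s 1 + s 2 + s 6 + s 7 - (Y + s 6)) * (s 0 + s 6 - (Y + s 6)) ≠ 0) :
    ContinuousAt (fun p : (Fin 8 → ℝ) × ℝ =>
      ((p.2 + p.1 6) * ((p.1 1 + p.1 2 + p.1 7 - p.2) * (p.1 0 - p.2)) - (p.2 - p.1 1) * (p.2 - p.1 2)
      * (p.2 - p.1 7)) * ((p.1 6 - p.2 + (p.1 6 - p.1 0) * ((p.2 - p.1 1) * (p.2 - p.1 2) * (p.2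
      - p.1 7)) / ((p.2 + p.1 6) * ((p.1 1 + p.1 2 + p.1 7 - p.2) * (p.1 0 - p.2)) - (p.2 - p.1
      1) * (p.2 - p.1 2) * (p.2 - p.1 7))) - (p.1 4 + p.1 6)) * ((p.1 6 - p.2 + (p.1 6 - p.1 0)
      * ((p.2 - p.1 1) * (p.2 - p.1 2) * (p.2 - p.1 7)) / ((p.2 + p.1 6) * ((p.1 1 + p.1 2 + p.1
      7 - p.2) * (p.1 0 - p.2)) - (p.2 - p.1 1) * (p.2 - p.1 2) * (p.2 - p.1 7))) - (p.1 3 + p.1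
      6)) * ((p.1 6 - p.2 + (p.1 6 - p.1 0) * ((p.2 - p.1 1) * (p.2 - p.1 2) * (p.2 - p.1 7)) /
      ((p.2 + p.1 6) * ((p.1 1 + p.1 2 + p.1 7 - p.2) * (p.1 0 - p.2)) - (p.2 - p.1 1) * (p.2 -
      p.1 2) * (p.2 - p.1 7))) - (p.1 5 + p.1 6)) * ((p.1 6 - p.2 + (p.1 6 - p.1 0) * ((p.2 -
      p.1 1) * (p.2 - p.1 2) * (p.2 - p.1 7)) / ((p.2 + p.1 6) * ((p.1 1 + p.1 2 + p.1 7 - p.2)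
      * (p.1 0 - p.2)) - (p.2 - p.1 1) * (p.2 - p.1 2) * (p.2 - p.1 7))) + (p.2 + p.1 6) - (p.1
      0 + p.1 6)) * (p.1 0 + p.1 6 - (p.1 6 - p.2 + (p.1 6 - p.1 0) * ((p.2 - p.1 1) * (p.2 -
      p.1 2) * (p.2 - p.1 7)) / ((p.2 + p.1 6) * ((p.1 1 + p.1 2 + p.1 7 - p.2) * (p.1 0 - p.2))
      - (p.2 - p.1 1) * (p.2 - p.1 2) * (p.2 - p.1 7)))) * (p.1 3 + p.1 4 + p.1 5 + p.1 6 - (p.1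
      6 - p.2 + (p.1 6 - p.1 0) * ((p.2 - p.1 1) * (p.2 - p.1 2) * (p.2 - p.1 7)) / ((p.2 + p.1
      6) * ((p.1 1 + p.1 2 + p.1 7 - p.2) * (p.1 0 - p.2)) - (p.2 - p.1 1) * (p.2 - p.1 2) *
      (p.2 - p.1 7)))) * ((p.1 6 - p.2 + (p.1 6 - p.1 0) * ((p.2 - p.1 1) * (p.2 - p.1 2) * (p.2
      - p.1 7)) / ((p.2 + p.1 6) * ((p.1 1 + p.1 2 + p.1 7 - p.2) * (p.1 0 - p.2)) - (p.2 - p.1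
      1) * (p.2 - p.1 2) * (p.2 - p.1 7))) + (p.2 + p.1 6) - 2 * p.1 6) * ((p.2 + p.1 6) - (p.1
      6 + p.1 7)) * ((p.2 + p.1 6) - (p.1 2 + p.1 6)) * ((p.2 + p.1 6) - (p.1 1 + p.1 6)) * (p.1
      1 + p.1 2 + p.1 6 + p.1 7 - (p.2 + p.1 6)) * (p.1 0 + p.1 6 - (p.2 + p.1 6))) (s, Y) := by
  obtain ⟨hQ, -⟩ := (critSide_ne_zero_iff s Y).mp hside
  fun_prop (disch := (dsimp only; assumption))

/-- **The value map is `C¹` in `(s, Y)` at an admissible root** (open box; side condition non-zero): the growth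
functional is a combination of logarithms of the non-vanishing arguments (`growthLogR_aOfS`, `fun_prop`). -/
theorem contDiffAt_critValue {s : Fin 8 → ℝ} {Y : ℝ} (hbox : ∀ j : Fin 7, 0 < s j.succ ∧ s j.succ < s 0)
    (hside : ((Y + s 6) * ((s 1 + s 2 + s 7 - Y) * (s 0 - Y)) - (Y - s 1) * (Y - s 2) * (Y - s 7)) * ((s 6 -
      Y + (s 6 - s 0) * ((Y - s 1) * (Y - s 2) * (Y - s 7)) / ((Y + s 6) * ((s 1 + s 2 + s 7 -
      Y) * (s 0 - Y)) - (Y - s 1) * (Y - s 2) * (Y - s 7))) - (s 4 + s 6)) * ((s 6 - Y + (s 6 -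
      s 0) * ((Y - s 1) * (Y - s 2) * (Y - s 7)) / ((Y + s 6) * ((s 1 + s 2 + s 7 - Y) * (s 0 -
      Y)) - (Y - s 1) * (Y - s 2) * (Y - s 7))) - (s 3 + s 6)) * ((s 6 - Y + (s 6 - s 0) * ((Y -
      s 1) * (Y - s 2) * (Y - s 7)) / ((Y + s 6) * ((s 1 + s 2 + s 7 - Y) * (s 0 - Y)) - (Y - s
      1) * (Y - s 2) * (Y - s 7))) - (s 5 + s 6)) * ((s 6 - Y + (s 6 - s 0) * ((Y - s 1) * (Y -
      s 2) * (Y - s 7)) / ((Y + s 6) * ((s 1 + s 2 + s 7 - Y) * (s 0 - Y)) - (Y - s 1) * (Y - s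
      2) * (Y - s 7))) + (Y + s 6) - (s 0 + s 6)) * (s 0 + s 6 - (s 6 - Y + (s 6 - s 0) * ((Y -
      s 1) * (Y - s 2) * (Y - s 7)) / ((Y + s 6) * ((s 1 + s 2 + s 7 - Y) * (s 0 - Y)) - (Y - s
      1) * (Y - s 2) * (Y - s 7)))) * (s 3 + s 4 + s 5 + s 6 - (s 6 - Y + (s 6 - s 0) * ((Y - s
      1) * (Y - s 2) * (Y - s 7)) / ((Y + s 6) * ((s 1 + s 2 + s 7 - Y) * (s 0 - Y)) - (Y - s 1)
      * (Y - s 2) * (Y - s 7)))) * ((s 6 - Y + (s 6 - s 0) * ((Y - s 1) * (Y - s 2) * (Y - s 7))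
      / ((Y + s 6) * ((s 1 + s 2 + s 7 - Y) * (s 0 - Y)) - (Y - s 1) * (Y - s 2) * (Y - s 7))) +
      (Y + s 6) - 2 * s 6) * ((Y + s 6) - (s 6 + s 7)) * ((Y + s 6) - (s 2 + s 6)) * ((Y + s 6)
      - (s 1 + s 6)) * (s 1 + s 2 + s 6 + s 7 - (Y + s 6)) * (s 0 + s 6 - (Y + s 6)) ≠ 0) :
    ContDiffAt ℝ 1 (fun p : (Fin 8 → ℝ) × ℝ =>
      growthLogR (pR (aOfS p.1)) (qR (aOfS p.1)) (p.1 6 - p.2 + (p.1 6 - p.1 0) * ((p.2 - p.1 1) *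
      (p.2 - p.1 2) * (p.2 - p.1 7)) / ((p.2 + p.1 6) * ((p.1 1 + p.1 2 + p.1 7 - p.2) * (p.1 0
      - p.2)) - (p.2 - p.1 1) * (p.2 - p.1 2) * (p.2 - p.1 7))) (p.2 + p.1 6)) (s, Y) := by
  obtain ⟨hQ, hv⟩ := (critSide_ne_zero_iff s Y).mp hside
  obtain ⟨h0, h1, h2, h3, h4, h5, h6, h7, h8, h9, h10, h11⟩ := (forall_critFactors_aOfS_iff s _ _).mp hv
  have b1 := hbox 0; have b2 := hbox 1; have b3 := hbox 2; have b4 := hbox 3; have b6 := hbox 5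
  simp only [Fin.succ_zero_eq_one] at b1
  change 0 < s 2 ∧ s 2 < s 0 at b2; change 0 < s 3 ∧ s 3 < s 0 at b3; change 0 < s 4 ∧ s 4 < s 0 at b4
  change 0 < s 6 ∧ s 6 < s 0 at b6
  have c1 : s 0 - s 3 ≠ 0 := by linarith [b3.2]
  have c2 : s 3 + s 4 ≠ 0 := by linarith [b3.1, b4.1]
  have c3 : s 1 + s 2 ≠ 0 := by linarith [b1.1, b2.1]
  have c4 : s 0 - s 2 ≠ 0 := by linarith [b2.2]
  have c5 : s 4 + s 6 ≠ 0 := by linarith [b4.1, b6.1]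
  have c6 : s 0 - s 6 ≠ 0 := by linarith [b6.2]
  have c7 : s 1 + s 6 ≠ 0 := by linarith [b1.1, b6.1]
  simp only [growthLogR_aOfS]
  fun_prop (disch := (dsimp only; assumption))

/-- **Bridge**: an admissible root gives a critical value (`ConeGammaCritCubic.isCritical_aOfS_of_root`). -/
theorem critValue_mem_critVals {s : Fin 8 → ℝ} {Y : ℝ}
    (hC : (-((Y + s 3) * (Y + s 4) * (Y + s 6) * (Y + s 5)) * (s 1 + s 2 + s 7 - Y) ^ 2 * (s 0 - Y) + (2 *
      Y ^ 3 - 2 * (s 0 - (s 3 + s 4 + s 6 + s 5)) * Y ^ 2 - (s 0 * (s 3 + s 4 + s 6 + s 5) - (s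
      3 * s 4 + s 3 * s 6 + s 3 * s 5 + s 4 * s 6 + s 4 * s 5 + s 6 * s 5)) * Y - (s 0 * (s 3 *
      s 4 + s 3 * s 6 + s 3 * s 5 + s 4 * s 6 + s 4 * s 5 + s 6 * s 5) - (s 3 * s 4 * s 6 + s 3
      * s 4 * s 5 + s 3 * s 6 * s 5 + s 4 * s 6 * s 5))) * (s 1 + s 2 + s 7 - Y) * ((Y - s 1) *
      (Y - s 2) * (Y - s 7)) + (Y - s 0 + (s 3 + s 4 + s 6 + s 5)) * ((Y - s 1) * (Y - s 2) * (Y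
      - s 7)) ^ 2) = 0)
    (hside : ((Y + s 6) * ((s 1 + s 2 + s 7 - Y) * (s 0 - Y)) - (Y - s 1) * (Y - s 2) * (Y - s 7)) * ((s 6 -
      Y + (s 6 - s 0) * ((Y - s 1) * (Y - s 2) * (Y - s 7)) / ((Y + s 6) * ((s 1 + s 2 + s 7 -
      Y) * (s 0 - Y)) - (Y - s 1) * (Y - s 2) * (Y - s 7))) - (s 4 + s 6)) * ((s 6 - Y + (s 6 -
      s 0) * ((Y - s 1) * (Y - s 2) * (Y - s 7)) / ((Y + s 6) * ((s 1 + s 2 + s 7 - Y) * (s 0 -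
      Y)) - (Y - s 1) * (Y - s 2) * (Y - s 7))) - (s 3 + s 6)) * ((s 6 - Y + (s 6 - s 0) * ((Y -
      s 1) * (Y - s 2) * (Y - s 7)) / ((Y + s 6) * ((s 1 + s 2 + s 7 - Y) * (s 0 - Y)) - (Y - s
      1) * (Y - s 2) * (Y - s 7))) - (s 5 + s 6)) * ((s 6 - Y + (s 6 - s 0) * ((Y - s 1) * (Y -
      s 2) * (Y - s 7)) / ((Y + s 6) * ((s 1 + s 2 + s 7 - Y) * (s 0 - Y)) - (Y - s 1) * (Y - s
      2) * (Y - s 7))) + (Y + s 6) - (s 0 + s 6)) * (s 0 + s 6 - (s 6 - Y + (s 6 - s 0) * ((Y -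
      s 1) * (Y - s 2) * (Y - s 7)) / ((Y + s 6) * ((s 1 + s 2 + s 7 - Y) * (s 0 - Y)) - (Y - s
      1) * (Y - s 2) * (Y - s 7)))) * (s 3 + s 4 + s 5 + s 6 - (s 6 - Y + (s 6 - s 0) * ((Y - s
      1) * (Y - s 2) * (Y - s 7)) / ((Y + s 6) * ((s 1 + s 2 + s 7 - Y) * (s 0 - Y)) - (Y - s 1)
      * (Y - s 2) * (Y - s 7)))) * ((s 6 - Y + (s 6 - s 0) * ((Y - s 1) * (Y - s 2) * (Y - s 7))
      / ((Y + s 6) * ((s 1 + s 2 + s 7 - Y) * (s 0 - Y)) - (Y - s 1) * (Y - s 2) * (Y - s 7))) +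
      (Y + s 6) - 2 * s 6) * ((Y + s 6) - (s 6 + s 7)) * ((Y + s 6) - (s 2 + s 6)) * ((Y + s 6)
      - (s 1 + s 6)) * (s 1 + s 2 + s 6 + s 7 - (Y + s 6)) * (s 0 + s 6 - (Y + s 6)) ≠ 0) :
    growthLogR (pR (aOfS s)) (qR (aOfS s)) (s 6 - Y + (s 6 - s 0) * ((Y - s 1) * (Y - s 2) * (Y - s
      7)) / ((Y + s 6) * ((s 1 + s 2 + s 7 - Y) * (s 0 - Y)) - (Y - s 1) * (Y - s 2) * (Y - s
      7))) (Y + s 6)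
      ∈ critVals (aOfS s) := by
  obtain ⟨hQ, hv⟩ := (critSide_ne_zero_iff s Y).mp hside
  have hc := isCritical_aOfS_of_root (s := s) (P := fun Y => ((Y - s 1) * (Y - s 2) * (Y - s 7)))
    (Q := fun Y => ((Y + s 6) * ((s 1 + s 2 + s 7 - Y) * (s 0 - Y)) - (Y - s 1) * (Y - s 2) * (Y - s 7)))
    (C := fun Y => (-((Y + s 3) * (Y + s 4) * (Y + s 6) * (Y + s 5)) * (s 1 + s 2 + s 7 - Y) ^ 2 * (s 0 - Y) + (2 *
      Y ^ 3 - 2 * (s 0 - (s 3 + s 4 + s 6 + s 5)) * Y ^ 2 - (s 0 * (s 3 + s 4 + s 6 + s 5) - (s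
      3 * s 4 + s 3 * s 6 + s 3 * s 5 + s 4 * s 6 + s 4 * s 5 + s 6 * s 5)) * Y - (s 0 * (s 3 *
      s 4 + s 3 * s 6 + s 3 * s 5 + s 4 * s 6 + s 4 * s 5 + s 6 * s 5) - (s 3 * s 4 * s 6 + s 3
      * s 4 * s 5 + s 3 * s 6 * s 5 + s 4 * s 6 * s 5))) * (s 1 + s 2 + s 7 - Y) * ((Y - s 1) *
      (Y - s 2) * (Y - s 7)) + (Y - s 0 + (s 3 + s 4 + s 6 + s 5)) * ((Y - s 1) * (Y - s 2) * (Y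
      - s 7)) ^ 2))
    (fun _ => rfl) (fun _ => rfl) (fun _ => rfl) hC hQ hv
  exact ⟨_, _, hc, rfl⟩

/-- The open box is open: a sup-ball around an open-box parameter stays in the open box. -/
theorem exists_openBox_ball {s : Fin 8 → ℝ} (hbox : ∀ j : Fin 7, 0 < s j.succ ∧ s j.succ < s 0) :
    ∃ η : ℝ, 0 < η ∧ ∀ s' : Fin 8 → ℝ, ‖s' - s‖ ≤ η → ∀ j : Fin 7, 0 < s' j.succ ∧ s' j.succ < s' 0 := by
  have hopen : IsOpen {t : Fin 8 → ℝ | ∀ j : Fin 7, 0 < t j.succ ∧ t j.succ < t 0} := by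
    simp only [Set.setOf_forall]
    exact isOpen_iInter_of_finite fun j =>
      (isOpen_lt continuous_const (continuous_apply _)).inter (isOpen_lt (continuous_apply _) (continuous_apply _))
  obtain ⟨ε, hε, hball⟩ := Metric.isOpen_iff.mp hopen s hbox
  refine ⟨ε / 2, by positivity, fun s' hs' => hball ?_⟩
  rw [Metric.mem_ball, dist_eq_norm]
  linarith

/-! ### Structure at a Regular open-box direction -/

/-- **At a Regular open-box direction**: the cubic factors as `a·(Y−Y₁)(Y−Y₂)(Y−Y₃)` with `a ≠ 0` and pairwise
distinct roots, each admissible (side condition non-zero), with values `v(Y₁) < v(Y₂) < v(Y₃)`. -/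
theorem exists_roots_of_regular {s : Fin 8 → ℝ} (hbox : ∀ j : Fin 7, 0 < s j.succ ∧ s j.succ < s 0)
    (hreg : Regular (aOfS s)) :
    ∃ Y₁ Y₂ Y₃ a : ℝ,
      (∀ Y : ℝ, (-((Y + s 3) * (Y + s 4) * (Y + s 6) * (Y + s 5)) * (s 1 + s 2 + s 7 - Y) ^ 2 * (s 0 - Y) + (2 *
        Y ^ 3 - 2 * (s 0 - (s 3 + s 4 + s 6 + s 5)) * Y ^ 2 - (s 0 * (s 3 + s 4 + s 6 + s 5) -
        (s 3 * s 4 + s 3 * s 6 + s 3 * s 5 + s 4 * s 6 + s 4 * s 5 + s 6 * s 5)) * Y - (s 0 * (s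
        3 * s 4 + s 3 * s 6 + s 3 * s 5 + s 4 * s 6 + s 4 * s 5 + s 6 * s 5) - (s 3 * s 4 * s 6
        + s 3 * s 4 * s 5 + s 3 * s 6 * s 5 + s 4 * s 6 * s 5))) * (s 1 + s 2 + s 7 - Y) * ((Y -
        s 1) * (Y - s 2) * (Y - s 7)) + (Y - s 0 + (s 3 + s 4 + s 6 + s 5)) * ((Y - s 1) * (Y -
        s 2) * (Y - s 7)) ^ 2)
        = a * ((Y - Y₁) * (Y - Y₂) * (Y - Y₃))) ∧ a ≠ 0 ∧ Y₁ ≠ Y₂ ∧ Y₁ ≠ Y₃ ∧ Y₂ ≠ Y₃ ∧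
      (fun Y : ℝ => ((Y + s 6) * ((s 1 + s 2 + s 7 - Y) * (s 0 - Y)) - (Y - s 1) * (Y - s 2) * (Y - s 7)) * ((s 6 -
        Y + (s 6 - s 0) * ((Y - s 1) * (Y - s 2) * (Y - s 7)) / ((Y + s 6) * ((s 1 + s 2 + s 7 -
        Y) * (s 0 - Y)) - (Y - s 1) * (Y - s 2) * (Y - s 7))) - (s 4 + s 6)) * ((s 6 - Y + (s 6
        - s 0) * ((Y - s 1) * (Y - s 2) * (Y - s 7)) / ((Y + s 6) * ((s 1 + s 2 + s 7 - Y) * (s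
        0 - Y)) - (Y - s 1) * (Y - s 2) * (Y - s 7))) - (s 3 + s 6)) * ((s 6 - Y + (s 6 - s 0) *
        ((Y - s 1) * (Y - s 2) * (Y - s 7)) / ((Y + s 6) * ((s 1 + s 2 + s 7 - Y) * (s 0 - Y)) -
        (Y - s 1) * (Y - s 2) * (Y - s 7))) - (s 5 + s 6)) * ((s 6 - Y + (s 6 - s 0) * ((Y - s
        1) * (Y - s 2) * (Y - s 7)) / ((Y + s 6) * ((s 1 + s 2 + s 7 - Y) * (s 0 - Y)) - (Y - s
        1) * (Y - s 2) * (Y - s 7))) + (Y + s 6) - (s 0 + s 6)) * (s 0 + s 6 - (s 6 - Y + (s 6 -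
        s 0) * ((Y - s 1) * (Y - s 2) * (Y - s 7)) / ((Y + s 6) * ((s 1 + s 2 + s 7 - Y) * (s 0
        - Y)) - (Y - s 1) * (Y - s 2) * (Y - s 7)))) * (s 3 + s 4 + s 5 + s 6 - (s 6 - Y + (s 6
        - s 0) * ((Y - s 1) * (Y - s 2) * (Y - s 7)) / ((Y + s 6) * ((s 1 + s 2 + s 7 - Y) * (s
        0 - Y)) - (Y - s 1) * (Y - s 2) * (Y - s 7)))) * ((s 6 - Y + (s 6 - s 0) * ((Y - s 1) *
        (Y - s 2) * (Y - s 7)) / ((Y + s 6) * ((s 1 + s 2 + s 7 - Y) * (s 0 - Y)) - (Y - s 1) *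
        (Y - s 2) * (Y - s 7))) + (Y + s 6) - 2 * s 6) * ((Y + s 6) - (s 6 + s 7)) * ((Y + s 6)
        - (s 2 + s 6)) * ((Y + s 6) - (s 1 + s 6)) * (s 1 + s 2 + s 6 + s 7 - (Y + s 6)) * (s 0
        + s 6 - (Y + s 6))) Y₁ ≠ 0 ∧
      (fun Y : ℝ => ((Y + s 6) * ((s 1 + s 2 + s 7 - Y) * (s 0 - Y)) - (Y - s 1) * (Y - s 2) * (Y - s 7)) * ((s 6 -
        Y + (s 6 - s 0) * ((Y - s 1) * (Y - s 2) * (Y - s 7)) / ((Y + s 6) * ((s 1 + s 2 + s 7 -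
        Y) * (s 0 - Y)) - (Y - s 1) * (Y - s 2) * (Y - s 7))) - (s 4 + s 6)) * ((s 6 - Y + (s 6
        - s 0) * ((Y - s 1) * (Y - s 2) * (Y - s 7)) / ((Y + s 6) * ((s 1 + s 2 + s 7 - Y) * (s
        0 - Y)) - (Y - s 1) * (Y - s 2) * (Y - s 7))) - (s 3 + s 6)) * ((s 6 - Y + (s 6 - s 0) *
        ((Y - s 1) * (Y - s 2) * (Y - s 7)) / ((Y + s 6) * ((s 1 + s 2 + s 7 - Y) * (s 0 - Y)) -
        (Y - s 1) * (Y - s 2) * (Y - s 7))) - (s 5 + s 6)) * ((s 6 - Y + (s 6 - s 0) * ((Y - s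
        1) * (Y - s 2) * (Y - s 7)) / ((Y + s 6) * ((s 1 + s 2 + s 7 - Y) * (s 0 - Y)) - (Y - s
        1) * (Y - s 2) * (Y - s 7))) + (Y + s 6) - (s 0 + s 6)) * (s 0 + s 6 - (s 6 - Y + (s 6 -
        s 0) * ((Y - s 1) * (Y - s 2) * (Y - s 7)) / ((Y + s 6) * ((s 1 + s 2 + s 7 - Y) * (s 0
        - Y)) - (Y - s 1) * (Y - s 2) * (Y - s 7)))) * (s 3 + s 4 + s 5 + s 6 - (s 6 - Y + (s 6
        - s 0) * ((Y - s 1) * (Y - s 2) * (Y - s 7)) / ((Y + s 6) * ((s 1 + s 2 + s 7 - Y) * (s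
        0 - Y)) - (Y - s 1) * (Y - s 2) * (Y - s 7)))) * ((s 6 - Y + (s 6 - s 0) * ((Y - s 1) *
        (Y - s 2) * (Y - s 7)) / ((Y + s 6) * ((s 1 + s 2 + s 7 - Y) * (s 0 - Y)) - (Y - s 1) *
        (Y - s 2) * (Y - s 7))) + (Y + s 6) - 2 * s 6) * ((Y + s 6) - (s 6 + s 7)) * ((Y + s 6)
        - (s 2 + s 6)) * ((Y + s 6) - (s 1 + s 6)) * (s 1 + s 2 + s 6 + s 7 - (Y + s 6)) * (s 0
        + s 6 - (Y + s 6))) Y₂ ≠ 0 ∧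
      (fun Y : ℝ => ((Y + s 6) * ((s 1 + s 2 + s 7 - Y) * (s 0 - Y)) - (Y - s 1) * (Y - s 2) * (Y - s 7)) * ((s 6 -
        Y + (s 6 - s 0) * ((Y - s 1) * (Y - s 2) * (Y - s 7)) / ((Y + s 6) * ((s 1 + s 2 + s 7 -
        Y) * (s 0 - Y)) - (Y - s 1) * (Y - s 2) * (Y - s 7))) - (s 4 + s 6)) * ((s 6 - Y + (s 6
        - s 0) * ((Y - s 1) * (Y - s 2) * (Y - s 7)) / ((Y + s 6) * ((s 1 + s 2 + s 7 - Y) * (s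
        0 - Y)) - (Y - s 1) * (Y - s 2) * (Y - s 7))) - (s 3 + s 6)) * ((s 6 - Y + (s 6 - s 0) *
        ((Y - s 1) * (Y - s 2) * (Y - s 7)) / ((Y + s 6) * ((s 1 + s 2 + s 7 - Y) * (s 0 - Y)) -
        (Y - s 1) * (Y - s 2) * (Y - s 7))) - (s 5 + s 6)) * ((s 6 - Y + (s 6 - s 0) * ((Y - s
        1) * (Y - s 2) * (Y - s 7)) / ((Y + s 6) * ((s 1 + s 2 + s 7 - Y) * (s 0 - Y)) - (Y - s
        1) * (Y - s 2) * (Y - s 7))) + (Y + s 6) - (s 0 + s 6)) * (s 0 + s 6 - (s 6 - Y + (s 6 -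
        s 0) * ((Y - s 1) * (Y - s 2) * (Y - s 7)) / ((Y + s 6) * ((s 1 + s 2 + s 7 - Y) * (s 0
        - Y)) - (Y - s 1) * (Y - s 2) * (Y - s 7)))) * (s 3 + s 4 + s 5 + s 6 - (s 6 - Y + (s 6
        - s 0) * ((Y - s 1) * (Y - s 2) * (Y - s 7)) / ((Y + s 6) * ((s 1 + s 2 + s 7 - Y) * (s
        0 - Y)) - (Y - s 1) * (Y - s 2) * (Y - s 7)))) * ((s 6 - Y + (s 6 - s 0) * ((Y - s 1) *
        (Y - s 2) * (Y - s 7)) / ((Y + s 6) * ((s 1 + s 2 + s 7 - Y) * (s 0 - Y)) - (Y - s 1) *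
        (Y - s 2) * (Y - s 7))) + (Y + s 6) - 2 * s 6) * ((Y + s 6) - (s 6 + s 7)) * ((Y + s 6)
        - (s 2 + s 6)) * ((Y + s 6) - (s 1 + s 6)) * (s 1 + s 2 + s 6 + s 7 - (Y + s 6)) * (s 0
        + s 6 - (Y + s 6))) Y₃ ≠ 0 ∧
      (fun Y : ℝ => growthLogR (pR (aOfS s)) (qR (aOfS s)) (s 6 - Y + (s 6 - s 0) * ((Y - s 1) * (Y - s 2) * (Y - s
        7)) / ((Y + s 6) * ((s 1 + s 2 + s 7 - Y) * (s 0 - Y)) - (Y - s 1) * (Y - s 2) * (Y - s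
        7))) (Y + s 6)) Y₁
        < (fun Y : ℝ => growthLogR (pR (aOfS s)) (qR (aOfS s)) (s 6 - Y + (s 6 - s 0) * ((Y - s 1) * (Y - s 2) * (Y - s
        7)) / ((Y + s 6) * ((s 1 + s 2 + s 7 - Y) * (s 0 - Y)) - (Y - s 1) * (Y - s 2) * (Y - s
        7))) (Y + s 6)) Y₂ ∧
      (fun Y : ℝ => growthLogR (pR (aOfS s)) (qR (aOfS s)) (s 6 - Y + (s 6 - s 0) * ((Y - s 1) * (Y - s 2) * (Y - s
        7)) / ((Y + s 6) * ((s 1 + s 2 + s 7 - Y) * (s 0 - Y)) - (Y - s 1) * (Y - s 2) * (Y - s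
        7))) (Y + s 6)) Y₂
        < (fun Y : ℝ => growthLogR (pR (aOfS s)) (qR (aOfS s)) (s 6 - Y + (s 6 - s 0) * ((Y - s 1) * (Y - s 2) * (Y - s
        7)) / ((Y + s 6) * ((s 1 + s 2 + s 7 - Y) * (s 0 - Y)) - (Y - s 1) * (Y - s 2) * (Y - s
        7))) (Y + s 6)) Y₃ := by
  have b6 := hbox 5
  change 0 < s 6 ∧ s 6 < s 0 at b6
  have h06 : s 6 ≠ s 0 := b6.2.ne
  have himg := critVals_aOfS_eq_image (s := s) (P := fun Y => ((Y - s 1) * (Y - s 2) * (Y - s 7)))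
    (Q := fun Y => ((Y + s 6) * ((s 1 + s 2 + s 7 - Y) * (s 0 - Y)) - (Y - s 1) * (Y - s 2) * (Y - s 7)))
    (C := fun Y => (-((Y + s 3) * (Y + s 4) * (Y + s 6) * (Y + s 5)) * (s 1 + s 2 + s 7 - Y) ^ 2 * (s 0 - Y) + (2 *
      Y ^ 3 - 2 * (s 0 - (s 3 + s 4 + s 6 + s 5)) * Y ^ 2 - (s 0 * (s 3 + s 4 + s 6 + s 5) - (s
      3 * s 4 + s 3 * s 6 + s 3 * s 5 + s 4 * s 6 + s 4 * s 5 + s 6 * s 5)) * Y - (s 0 * (s 3 *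
      s 4 + s 3 * s 6 + s 3 * s 5 + s 4 * s 6 + s 4 * s 5 + s 6 * s 5) - (s 3 * s 4 * s 6 + s 3
      * s 4 * s 5 + s 3 * s 6 * s 5 + s 4 * s 6 * s 5))) * (s 1 + s 2 + s 7 - Y) * ((Y - s 1) *
      (Y - s 2) * (Y - s 7)) + (Y - s 0 + (s 3 + s 4 + s 6 + s 5)) * ((Y - s 1) * (Y - s 2) * (Y
      - s 7)) ^ 2))
    (fun _ => rfl) (fun _ => rfl) (fun _ => rfl) h06
  obtain ⟨u, v, w, huv, huw, hvw, hset⟩ := Set.ncard_eq_three.mp hreg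
  obtain ⟨x, y, z, hxy, hyz, hset'⟩ := exists_sorted_three huv huw hvw
  rw [hset', himg] at hset
  have hx : x ∈ ({x, y, z} : Set ℝ) := by simp
  have hy : y ∈ ({x, y, z} : Set ℝ) := by simp
  have hz : z ∈ ({x, y, z} : Set ℝ) := by simp
  rw [← hset] at hx hy hz
  obtain ⟨Y₁, ⟨hC₁, hQ₁, hv₁⟩, hV₁⟩ := hx
  obtain ⟨Y₂, ⟨hC₂, hQ₂, hv₂⟩, hV₂⟩ := hy
  obtain ⟨Y₃, ⟨hC₃, hQ₃, hv₃⟩, hV₃⟩ := hz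
  dsimp only at hC₁ hC₂ hC₃ hQ₁ hQ₂ hQ₃ hv₁ hv₂ hv₃ hV₁ hV₂ hV₃
  have h12 : Y₁ ≠ Y₂ := by rintro rfl; exact hxy.ne (hV₁.symm.trans hV₂)
  have h13 : Y₁ ≠ Y₃ := by rintro rfl; exact (hxy.trans hyz).ne (hV₁.symm.trans hV₃)
  have h23 : Y₂ ≠ Y₃ := by rintro rfl; exact hyz.ne (hV₂.symm.trans hV₃)
  obtain ⟨a, b, c, d, habcd⟩ := exists_cubic_coeffs (s := s)
    (C := fun Y => (-((Y + s 3) * (Y + s 4) * (Y + s 6) * (Y + s 5)) * (s 1 + s 2 + s 7 - Y) ^ 2 * (s 0 - Y) + (2 *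
      Y ^ 3 - 2 * (s 0 - (s 3 + s 4 + s 6 + s 5)) * Y ^ 2 - (s 0 * (s 3 + s 4 + s 6 + s 5) - (s
      3 * s 4 + s 3 * s 6 + s 3 * s 5 + s 4 * s 6 + s 4 * s 5 + s 6 * s 5)) * Y - (s 0 * (s 3 *
      s 4 + s 3 * s 6 + s 3 * s 5 + s 4 * s 6 + s 4 * s 5 + s 6 * s 5) - (s 3 * s 4 * s 6 + s 3
      * s 4 * s 5 + s 3 * s 6 * s 5 + s 4 * s 6 * s 5))) * (s 1 + s 2 + s 7 - Y) * ((Y - s 1) *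
      (Y - s 2) * (Y - s 7)) + (Y - s 0 + (s 3 + s 4 + s 6 + s 5)) * ((Y - s 1) * (Y - s 2) * (Y
      - s 7)) ^ 2)) (fun _ => rfl)
  have hneg := cubic_at_s1_neg (s := s)
    (C := fun Y => (-((Y + s 3) * (Y + s 4) * (Y + s 6) * (Y + s 5)) * (s 1 + s 2 + s 7 - Y) ^ 2 * (s 0 - Y) + (2 *
      Y ^ 3 - 2 * (s 0 - (s 3 + s 4 + s 6 + s 5)) * Y ^ 2 - (s 0 * (s 3 + s 4 + s 6 + s 5) - (s
      3 * s 4 + s 3 * s 6 + s 3 * s 5 + s 4 * s 6 + s 4 * s 5 + s 6 * s 5)) * Y - (s 0 * (s 3 *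
      s 4 + s 3 * s 6 + s 3 * s 5 + s 4 * s 6 + s 4 * s 5 + s 6 * s 5) - (s 3 * s 4 * s 6 + s 3
      * s 4 * s 5 + s 3 * s 6 * s 5 + s 4 * s 6 * s 5))) * (s 1 + s 2 + s 7 - Y) * ((Y - s 1) *
      (Y - s 2) * (Y - s 7)) + (Y - s 0 + (s 3 + s 4 + s 6 + s 5)) * ((Y - s 1) * (Y - s 2) * (Y
      - s 7)) ^ 2)) (fun _ => rfl) hbox
  have hfac := cubicFun_eq_prod_of_roots habcd hC₁ hC₂ hC₃ h12 h13 h23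
  have ha := cubicFun_leadCoeff_ne_zero habcd hC₁ hC₂ hC₃ h12 h13 h23 hneg.ne
  refine ⟨Y₁, Y₂, Y₃, a, hfac, ha, h12, h13, h23, (critSide_ne_zero_iff s Y₁).mpr ⟨hQ₁, hv₁⟩,
    (critSide_ne_zero_iff s Y₂).mpr ⟨hQ₂, hv₂⟩, (critSide_ne_zero_iff s Y₃).mpr ⟨hQ₃, hv₃⟩, ?_, ?_⟩
  · dsimp only; rw [hV₁, hV₂]; exact hxy
  · dsimp only; rw [hV₂, hV₃]; exact hyz

end Summit.KontsevichZagierPeriods.Zeta5Search.Barrier.ConeGamma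

end
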